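import Summits.CriticalPhenomena.PercolationContinuityZ3.Theorems.Transplant.PlanarSkeletonFrmQuasiDefs
import Summits.CriticalPhenomena.PercolationContinuityZ3.Theorems.Transplant.SkelFrmQuasiBChoiceRootRun
import Summits.CriticalPhenomena.PercolationContinuityZ3.Theorems.Transplant.SkelFrmBChoiceRootRun
import Summits.CriticalPhenomena.PercolationContinuityZ3.Theorems.Transplant.SkelFrmQuasiBChoiceRootRunY
import Summits.CriticalPhenomena.PercolationContinuityZ3.Theorems.Transplant.SkelFrmBChoiceRootRunY
import Summits.CriticalPhenomena.PercolationContinuityZ3.Theorems.Transplant.SkelFrmQuasi1ChoiceDefs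
import Summits.CriticalPhenomena.PercolationContinuityZ3.Theorems.Transplant.SkelFrmQuasi1ParamsLBL
import Summits.CriticalPhenomena.PercolationContinuityZ3.Theorems.Transplant.SkelFrmQuasi1ParamsPO
import Summits.CriticalPhenomena.PercolationContinuityZ3.Theorems.Transplant.SkelFrmQuasiBChoiceNums
import Summits.CriticalPhenomena.PercolationContinuityZ3.Theorems.Transplant.SkelFrmQuasiBParamsBridge0
import Summits.CriticalPhenomena.PercolationContinuityZ3.Theorems.Transplant.SkelFrmQuasiBParamsCorrKG
import Summits.CriticalPhenomena.PercolationContinuityZ3.Theorems.Transplant.SkelFrmQuasiBParamsCorrKG0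
import Summits.CriticalPhenomena.PercolationContinuityZ3.Theorems.Transplant.SkelFrmQuasiBParamsCorrKGLen3
import Summits.CriticalPhenomena.PercolationContinuityZ3.Theorems.Transplant.SkelFrmQuasiBParamsCorrKGY
import Summits.CriticalPhenomena.PercolationContinuityZ3.Theorems.Transplant.SkelFrmQuasiBParamsLF
import HarnessLib
import Summits.CriticalPhenomena.PercolationContinuityZ3.Theorems.Transplant.SkelFrmBChoiceRootDepthR
/-!
# GEN-Q PORT (WAVE-Q table v0.8 section 2, row G147, U-level L?; captain R-6/R-7 2026-08-27: carrier token swap `PlanarSkeletonFrmFrom ↦ PlanarSkeletonFrmQuasi`)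
# of the tree module «Transplant/SkelFrmFromBChoiceRootDepthR» (sha256 e3305a68774c5d9b…) onto the quasi-step carrier `PlanarSkeletonFrmQuasi` (p507026): «SkelFrmQuasiBChoiceRootDepthR»

ORIGINAL TITLE: N2 (frames-only node `SamePDropOfSkeletonFrm₁`, OPEN), (R) column — **THE DEPTH ROWS' REACH, TRANSFERRED FROM (C) TO THE ROOT** (both axes):

builds on p205010 (kernel theorem, internal audit signed; external expert review pending) — nothing in this file uses p205010; NOTHING is claimed about any open node
((N3-b), the end state).  Lane `prim-bschramm`, seat `prim-hp-8` (gen 62; GEN-Q pen, family BChoiceRoot*/1Root*/BParamsKit·Bridge; tool = captain gen-1 g4's port_genq.py R-14 + p3-g30 T1/T2 + stmt-g33 --force-keep).  Helper file (`--supports stmt-CriticalPhenomena-4575 --as helper`).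
PORT RULES (U-wave r1–r4 re-used, GEN-Q hunk classes of p3-g29 #6136): declaration order, names and proof texts are those of «SkelFrmFromBChoiceRootDepthR», byte-identical except
(i) the carrier token `PlanarSkeletonFrmFrom ↦ PlanarSkeletonFrmQuasi` in binders, `namespace`/`end` lines and qualified names (module names `SkelFrmFrom… ↦ SkelFrmQuasi…`
in imports of already-ported rows); (ii) `Φ.step ↦ Φ.qstep` with the called Steps lemma replaced by its `…Q`/`_q` twin and the cost `Φ.M` threaded (none in this file unless
listed below); (iii) `Φ.cyl_connected ↦ Φ.cyl_reach` readers (none unless listed); (iv) graph-ball radii / window floors ×`Φ.M` (none unless listed).  HAND HUNKS: (L-FLOORMAP-1 ⑤, refuter p5-g28 #6356 / p5-g29 13:02Z — the (R)-column depth rows carry the quasi-step cost like gen-2's `reach_le_ZD2 / reachY_le_ZDYW` (G108/G140)): in `reachR1_le` / `reachRY_le` the reach comparison reads `Φ.M * 13 * (…)` on BOTH sides (hypothesis `hC` and conclusion, left-assoc); the proofs gain the monotone step `Φ.M * (13·a) ≤ Φ.M * (13·(b + s))` (`mul_le_mul_of_nonneg_left`) before the original `linarith`. (L-KitS-1 /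 L-FLOORMAP-1 ⑧): the kit's R′ is read at the window cost of
record — `KS0.R'0 κ Φ t p D mk ↦ KS0.R'0N κ Φ (KS.NQ Φ) t p D mk` (stmt-g33's G017 «SkelFrmQuasiBChoiceNums», hp-8's «SkelFrmQuasiBParamsKitSN»).  Carrier-free
residents stay imported/exported from the original «SkelFrmBChoiceRootDepthR» exactly as in the FrmFrom port.  Docstrings and citations are the original's.

-/

noncomputable section

open scoped Classical

namespace Summit.CriticalPhenomena.PercolationContinuityZ3.Theorems.Transplant

namespace Skelφ

section ZMono

variable {n ℓ : ℕ} {hs v : ℤ} {R' ρ q W : ℕ}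

end ZMono

end Skelφ

namespace PlanarSkeletonFrmQuasi

namespace NegB

open Literature.Probability.Percolation Literature.Probability.LatticeModels SimpleGraph
open SkelConc (Consts)
open Skelφ (shearUnit kgSL kgSLY KGRows KGYRows kgM₁ kgM₂ kgWm₂ kgWp₂ kgZ₀ kgZ₁ kgM₁Y kgM₂Y kgWm₂Y kgWp₂Y kgZY₀ kgZY₁ kgDec₁ kgDec₁Y)
open Neg

namespace KS

section DepthR

variable (κ : Consts) {V : Type} [DecidableEq V] [Countable V] {G : SimpleGraph V} [G.LocallyFinite] (Φ : PlanarSkeletonFrmQuasi G) (t : V) (p : unitInterval)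
  (D : Skelφ.StepI.DataNS V) (mk g f qx Wx qxY WxY : ℕ)

/-- **FIRST AXIS**: the root's reach `Φ.M·13·((N_R+1)n_L + Z₀(N_R) + Z₁(N_R))` (× the quasi-step cost `Φ.M`, GEN-Q ⑤) is at most (C)'s reach bound `Z` plus `Φ.M·13·sL` (`dec₁ ≤ sL`). [this work] -/
theorem reachR1_le (κ : Consts) {V : Type} [DecidableEq V] [Countable V] {G : SimpleGraph V} [G.LocallyFinite] (Φ : PlanarSkeletonFrmQuasi G) (t : V) (p : unitInterval) (D : Skelφ.StepI.DataNS V) (mk : ℕ) (g : ℕ) (f : ℕ) (qx : ℕ) (Wx : ℕ) (hN : EqNumL κ Φ t p D g f) (hg : gFloorKG κ Φ t p D mk ≤ g) (hg2 : 40 * Neg.K κ * KS0.R'0N κ Φ (KS.NQ Φ) t p D mk ≤ g)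
    (hqx : qx ≤ 100 * nL κ Φ t p D g f) (hWx : (Wx : ℤ) ≤ 20 * (kgSL (nL κ Φ t p D g f) (ℓL κ Φ t p D g f) (hL κ Φ t p D g f))) (hf : KS.fxR0 κ Φ t p D mk ≤ f) (Z : ℤ)
    (hC : Φ.M * 13 * ((((((kgNv0 κ Φ t p D g f mk qx Wx) : ℕ)) : ℤ) + 1) * (nL κ Φ t p D g f : ℤ) + (kgZ₀ (nL κ Φ t p D g f) (vL κ Φ t p D g f) (kgR κ Φ t p D mk) 0 (kgq κ Φ t p D g f qx) (kgNv0 κ Φ t p D g f mk qx Wx) (kgM₁ (nL κ Φ t p D g f) (ℓL κ Φ t p D g f) (hL κ Φ t p D g f) (kgR κ Φ t p D mk) 0 (kgW κ Φ t p D g f Wx) (kgNv0 κ Φ t p D g f mk qx Wx)) (kgM₂ (nL κ Φ t p D g f) (ℓL κ Φ t p D g f) (hL κ Φ t p D g f) (vL κ Φ t p D g f) (kgR κ Φ t p D mk) 0 (kgq κ Φ t p D g f qx) (kgW κ Φ t p D g f Wx) (kgNv0 κ Φ t p D g f mk qx Wx))) + (kgZ₁ (nL κ Φ t p D g f) (ℓL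 κ Φ t p D g f) (hL κ Φ t p D g f) (kgR κ Φ t p D mk) 0 (kgW κ Φ t p D g f Wx) (kgNv0 κ Φ t p D g f mk qx Wx) (kgM₁ (nL κ Φ t p D g f) (ℓL κ Φ t p D g f) (hL κ Φ t p D g f) (kgR κ Φ t p D mk) 0 (kgW κ Φ t p D g f Wx) (kgNv0 κ Φ t p D g f mk qx Wx)) (kgWm₂ (nL κ Φ t p D g f) (ℓL κ Φ t p D g f) (hL κ Φ t p D g f) (kgR κ Φ t p D mk) 0 (kgW κ Φ t p D g f Wx) (kgNv0 κ Φ t p D g f mk qx Wx)) (kgWp₂ (nL κ Φ t p D g f) (ℓL κ Φ t p D g f) (hL κ Φ t p D g f) (kgR κ Φ t p D mk) 0 (kgW κ Φ t p D g f Wx) (kgNv0 κ Φ t p D g f mk qx Wx)) (kgM₂ (nL κ Φ t p D g f) (ℓL κ Φ t p D g f) (hL κ Φ t p D g f) (vL κ Φ t p D g f) (kgR κ Φ t p D mk) 0 (kgq κ Φ t p D g f qx) (kgW κ Φ t p D g f Wx) (kgNv0 κ Φ t p D g f mk qx Wx)))) ≤ Z) :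
    Φ.M * 13 * ((((((KS.kgNR κ Φ t p D mk g f qx Wx) : ℕ)) : ℤ) + 1) * (nL κ Φ t p D g f : ℤ) + (kgZ₀ (nL κ Φ t p D g f) (vL κ Φ t p D g f) (kgR κ Φ t p D mk) 0 (kgq κ Φ t p D g f qx) (KS.kgNR κ Φ t p D mk g f qx Wx) (kgM₁ (nL κ Φ t p D g f) (ℓL κ Φ t p D g f) (hL κ Φ t p D g f) (kgR κ Φ t p D mk) 0 (kgW κ Φ t p D g f Wx) (KS.kgNR κ Φ t p D mk g f qx Wx)) (kgM₂ (nL κ Φ t p D g f) (ℓL κ Φ t p D g f) (hL κ Φ t p D g f) (vL κ Φ t p D g f) (kgR κ Φ t p D mk) 0 (kgq κ Φ t p D g f qx) (kgW κ Φ t p D g f Wx) (KS.kgNR κ Φ t p D mk g f qx Wx))) + (kgZ₁ (nL κ Φ t p D g f) (ℓL κ Φ t p D g f) (hL κ Φ t p D g f) (kgR κ Φ t p D mk) 0 (kgW κ Φ t p D g f Wx) (KS.kgNR κ Φ t p D mk g f qx Wx) (kgM₁ (nL κ Φ t p D g f) (ℓL κ Φ t p D g f) (hL κ Φ t p D g f)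 (kgR κ Φ t p D mk) 0 (kgW κ Φ t p D g f Wx) (KS.kgNR κ Φ t p D mk g f qx Wx)) (kgWm₂ (nL κ Φ t p D g f) (ℓL κ Φ t p D g f) (hL κ Φ t p D g f) (kgR κ Φ t p D mk) 0 (kgW κ Φ t p D g f Wx) (KS.kgNR κ Φ t p D mk g f qx Wx)) (kgWp₂ (nL κ Φ t p D g f) (ℓL κ Φ t p D g f) (hL κ Φ t p D g f) (kgR κ Φ t p D mk) 0 (kgW κ Φ t p D g f Wx) (KS.kgNR κ Φ t p D mk g f qx Wx)) (kgM₂ (nL κ Φ t p D g f) (ℓL κ Φ t p D g f) (hL κ Φ t p D g f) (vL κ Φ t p D g f) (kgR κ Φ t p D mk) 0 (kgq κ Φ t p D g f qx) (kgW κ Φ t p D g f Wx) (KS.kgNR κ Φ t p D mk g f qx Wx)))) ≤ Z + Φ.M * 13 * (kgSL (nL κ Φ t p D g f) (ℓL κ Φ t p D g f) (hL κ Φ t p D g f)) := by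
  have H := kgRows0_of κ Φ t p D g f mk qx Wx hN hg
  have hle := kgNR_le_kgNv0 κ Φ t p D mk g f qx Wx hN hg hg2 hqx hWx hf
  obtain ⟨hZ₀, -⟩ := reachR_le κ Φ t p D mk g f qx Wx hN hg hg2 hqx hWx hf
  have hZ₁ := H.kgZ₁_le_add_of_le hle
  have hd : kgDec₁ (nL κ Φ t p D g f) (ℓL κ Φ t p D g f) (hL κ Φ t p D g f) (kgR κ Φ t p D mk) 0 ≤ (kgSL (nL κ Φ t p D g f) (ℓL κ Φ t p D g f) (hL κ Φ t p D g f)) := by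
    unfold kgDec₁; have : (0 : ℤ) ≤ (((kgR κ Φ t p D mk) : ℕ) : ℤ) := by positivity
    push_cast; linarith
  have key : ∀ {a b s : ℤ}, 13 * a ≤ 13 * b + 13 * s → (Φ.M : ℤ) * 13 * b ≤ Z → (Φ.M : ℤ) * 13 * a ≤ Z + (Φ.M : ℤ) * 13 * s := by
    intro a b s h hC'
    have hM : (0 : ℤ) ≤ (Φ.M : ℤ) := by positivity
    nlinarith [mul_le_mul_of_nonneg_left h hM]
  refine key ?_ hC
  linarith

/-- **SECOND AXIS**: the root y′-corridor's reach `Φ.M·13·((N+1)P + ZY₀^R + ZY₁^R)` (× the quasi-step cost `Φ.M`, GEN-Q ⑤) at `N = kgNYv0` is at most (C)'s reach bound `Z` plus `Φ.M·13·n_L`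
(`ZY₀^R ≤ ZY₀^C + dec₁Y − 1`, `ZY₁^R ≤ ZY₁^C`, `dec₁Y ≤ n_L`). [this work] -/
theorem reachRY_le (κ : Consts) {V : Type} [DecidableEq V] [Countable V] {G : SimpleGraph V} [G.LocallyFinite] (Φ : PlanarSkeletonFrmQuasi G) (t : V) (p : unitInterval) (D : Skelφ.StepI.DataNS V) (mk : ℕ) (g : ℕ) (f : ℕ) (qxY : ℕ) (WxY : ℕ) (hN : EqNumL κ Φ t p D g f) (hg : gFloorKG κ Φ t p D mk ≤ g) (Z : ℤ)
    (hC : Φ.M * 13 * ((((((kgNYv0 κ Φ t p D g f mk qxY WxY) : ℕ)) : ℤ) + 1) * ((((nL κ Φ t p D g f) * (ℓL κ Φ t p D g f) / Skelφ.shearUnit (nL κ Φ t p D g f) (hL κ Φ t p D g f) + 1 : ℕ)) : ℤ) + (kgZY₀ (nL κ Φ t p D g f) (vL κ Φ t p D g f) (kgR κ Φ t p D mk) 0 (kgWY κ Φ t p D g f WxY) (kgNYv0 κ Φ t p D g f mk qxY WxY) (kgM₁Y (nL κ Φ t p D g f) (vL κ Φ t p D g f) (kgR κ Φ t p D mk)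 0 (kgWY κ Φ t p D g f WxY) (kgNYv0 κ Φ t p D g f mk qxY WxY)) (kgWm₂Y (nL κ Φ t p D g f) (vL κ Φ t p D g f) (kgR κ Φ t p D mk) 0 (kgWY κ Φ t p D g f WxY) (kgNYv0 κ Φ t p D g f mk qxY WxY)) (kgWp₂Y (nL κ Φ t p D g f) (vL κ Φ t p D g f) (kgR κ Φ t p D mk) 0 (kgWY κ Φ t p D g f WxY) (kgNYv0 κ Φ t p D g f mk qxY WxY)) (kgM₂Y (nL κ Φ t p D g f) (ℓL κ Φ t p D g f) (hL κ Φ t p D g f) (vL κ Φ t p D g f) (kgR κ Φ t p D mk) 0 (kgqY κ Φ t p D g f qxY) (kgWY κ Φ t p D g f WxY) (kgNYv0 κ Φ t p D g f mk qxY WxY))) + (kgZY₁ (nL κ Φ t p D g f) (ℓL κ Φ t p D g f) (hL κ Φ t p D g f) (kgR κ Φ t p D mk) 0 (kgqY κ Φ t p D g f qxY) (kgNYv0 κ Φ t p D g f mk qxY WxY) (kgM₁Y (nL κ Φ t p D g f) (vL κ Φ t p D g f) (kgR κ Φ t p D mk) 0 (kgWY κ Φ t p D g f WxY) (kgNYv0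 κ Φ t p D g f mk qxY WxY)) (kgM₂Y (nL κ Φ t p D g f) (ℓL κ Φ t p D g f) (hL κ Φ t p D g f) (vL κ Φ t p D g f) (kgR κ Φ t p D mk) 0 (kgqY κ Φ t p D g f qxY) (kgWY κ Φ t p D g f WxY) (kgNYv0 κ Φ t p D g f mk qxY WxY)))) ≤ Z) :
    Φ.M * 13 * ((((((kgNYv0 κ Φ t p D g f mk qxY WxY) : ℕ)) : ℤ) + 1) * ((((nL κ Φ t p D g f) * (ℓL κ Φ t p D g f) / Skelφ.shearUnit (nL κ Φ t p D g f) (hL κ Φ t p D g f) + 1 : ℕ)) : ℤ) + (kgZY₀ (nL κ Φ t p D g f) (vL κ Φ t p D g f) (kgR κ Φ t p D mk) 0 (kgWY κ Φ t p D g f (KS.WxYR κ Φ t p D mk g f WxY)) (kgNYv0 κ Φ t p D g f mk qxY WxY) (kgM₁Y (nL κ Φ t p D g f) (vL κ Φ t p D g f) (kgR κ Φ t p D mk) 0 (kgWY κ Φ t p D g f (KS.WxYR κ Φ t p D mk g f WxY)) (kgNYv0 κ Φ t p D g f mk qxY WxY)) (kgWm₂Y (nL κ Φ t p D g f) (vL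 κ Φ t p D g f) (kgR κ Φ t p D mk) 0 (kgWY κ Φ t p D g f (KS.WxYR κ Φ t p D mk g f WxY)) (kgNYv0 κ Φ t p D g f mk qxY WxY)) (kgWp₂Y (nL κ Φ t p D g f) (vL κ Φ t p D g f) (kgR κ Φ t p D mk) 0 (kgWY κ Φ t p D g f (KS.WxYR κ Φ t p D mk g f WxY)) (kgNYv0 κ Φ t p D g f mk qxY WxY)) (kgM₂Y (nL κ Φ t p D g f) (ℓL κ Φ t p D g f) (hL κ Φ t p D g f) (vL κ Φ t p D g f) (kgR κ Φ t p D mk) 0 (kgqY κ Φ t p D g f qxY) (kgWY κ Φ t p D g f (KS.WxYR κ Φ t p D mk g f WxY)) (kgNYv0 κ Φ t p D g f mk qxY WxY))) + (kgZY₁ (nL κ Φ t p D g f) (ℓL κ Φ t p D g f) (hL κ Φ t p D g f) (kgR κ Φ t p D mk) 0 (kgqY κ Φ t p D g f qxY) (kgNYv0 κ Φ t p D g f mk qxY WxY) (kgM₁Y (nL κ Φ t p D g f) (vL κ Φ t p D g f) (kgR κ Φ t p D mk) 0 (kgWY κ Φ t p D g f (KS.WxYR κ Φ t p D mk g f WxY))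 (kgNYv0 κ Φ t p D g f mk qxY WxY)) (kgM₂Y (nL κ Φ t p D g f) (ℓL κ Φ t p D g f) (hL κ Φ t p D g f) (vL κ Φ t p D g f) (kgR κ Φ t p D mk) 0 (kgqY κ Φ t p D g f qxY) (kgWY κ Φ t p D g f (KS.WxYR κ Φ t p D mk g f WxY)) (kgNYv0 κ Φ t p D g f mk qxY WxY)))) ≤ Z + Φ.M * 13 * (nL κ Φ t p D g f : ℤ) := by
  obtain ⟨hZ₀, hZ₁⟩ := ZY_R_le κ Φ t p D mk g f qxY WxY hN hg (kgNYv0 κ Φ t p D g f mk qxY WxY)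
  have hd : kgDec₁Y (nL κ Φ t p D g f) (kgR κ Φ t p D mk) 0 ≤ (nL κ Φ t p D g f : ℤ) := by
    unfold kgDec₁Y; have : (0 : ℤ) ≤ (((kgR κ Φ t p D mk) : ℕ) : ℤ) := by positivity
    push_cast; linarith
  have key : ∀ {a b s : ℤ}, 13 * a ≤ 13 * b + 13 * s → (Φ.M : ℤ) * 13 * b ≤ Z → (Φ.M : ℤ) * 13 * a ≤ Z + (Φ.M : ℤ) * 13 * s := by
    intro a b s h hC'
    have hM : (0 : ℤ) ≤ (Φ.M : ℤ) := by positivity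
    nlinarith [mul_le_mul_of_nonneg_left h hM]
  refine key ?_ hC
  linarith

end DepthR

end KS

end NegB

end PlanarSkeletonFrmQuasi

end Summit.CriticalPhenomena.PercolationContinuityZ3.Theorems.Transplant

end
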